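import Mathlib
import HarnessLib
import HarnessLib.Audit
import Summits.SmoothPoincare4.Statement
import HarnessLib.Audit.Status.Attr

/-!
Route: DiophantineRotations

DORMANT since 2026-08-24T15:43:20Z (reconciler: no traction for 6.9 d (last activity item-evidence-added at 2026-08-17T18:12:59Z); parked, not closed — `ledger route dormant route-SmoothPoincare4-DiophantineRotations --off` to reactivat) — unstaffed, not closed; items shared with open routes are served there. `ledger route dormant <id> --off` reactivates.

# Route DiophantineRotations — fake 4-spheres cannot rotate — Herman–Yoccoz rigidity two dimensions
up decides SPC4

It suffices to show X = K1 ∧ K2 (card fake-spheres-cannot-idle, spine and only card; K1 sharpened to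
its smooth-linearisation form, two Σ-free
local rungs added). Write R = R_{α,β} for the linear bi-rotation of the round S⁴ ⊂ ℂ² ⊕ ℝ (rotate z₁
by 2πα, z₂ by 2πβ, fix the last coordinate),
with (α,β) SIMULTANEOUSLY DIOPHANTINE (γ ≤ |k₁α+k₂β+m|·(|k₁|+|k₂|)^τ for all (k₁,k₂) ≠ 0, m ∈ ℤ). K1
(DIOPHANTINE RIGIDITY, rank 2): a self-diffeomorphism
F of a smooth 4-manifold M that is C⁰-conjugate to R through a homeomorphism h : M ≃ₜ S⁴ is
C^∞-conjugate to R through a diffeomorphism θ : M ≃ₘ S⁴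
(Herman–Yoccoz rigidity in dimension four; in particular M ≅ S⁴). K2 (QUASI-PERIODIC EXISTENCE, rank
3): every smooth homotopy 4-sphere carries such
a pair (F, h). The deciding theorem uses K1 and K2 only; the local cruxes LocalDiophantineRigidity
(rank 4: the same rigidity for a germ at a fixed
point in ℝ⁴ under a C⁰ conjugacy) and PuncturedConeRigidity (rank 5: the conjugacy smooth off the
fixed point — the first rung) are the Σ-free pole
cases every proof of K1 must contain, and the support NoIdling records the card's unconditional
Theorem D in isometric form.
Lean: `(∀ (M : Type) [TopologicalSpace M] [T2Space M] [SecondCountableTopology M] [ChartedSpace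
(EuclideanSpace ℝ (Fin 4)) M] [IsManifold (𝓡 4) (⊤ : ℕ∞) M] (F : Diffeomorph (𝓡 4) (𝓡 4) M M (⊤ :
ℕ∞)) (h : M ≃ₜ Metric.sphere (0 : EuclideanSpace ℝ (Fin 5)) 1) (α β : ℝ), (∃ γ τ : ℝ, 0 < γ ∧ ∀ k₁
k₂ m : ℤ, (k₁ ≠ 0 ∨ k₂ ≠ 0) → γ ≤ |(k₁ : ℝ) * α + (k₂ : ℝ) * β + (m : ℝ)| * (|(k₁ : ℝ)| + |(k₂ :
ℝ)|) ^ τ) → (∀ x : M, ((h (F x) : Metric.sphere (0 : EuclideanSpace ℝ (Fin 5)) 1) : EuclideanSpace ℝ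
(Fin 5)) = WithLp.toLp 2 ![Real.cos (2 * Real.pi * α) * (h x : EuclideanSpace ℝ (Fin 5)) 0 -
Real.sin (2 * Real.pi * α) * (h x : EuclideanSpace ℝ (Fin 5)) 1, Real.sin (2 * Real.pi * α) * (h x :
EuclideanSpace ℝ (Fin 5)) 0 + Real.cos (2 * Real.pi * α) * (h x : EuclideanSpace ℝ (Fin 5)) 1,
Real.cos (2 * Real.pi * β) * (h x : EuclideanSpace ℝ (Fin 5)) 2 - Real.sin (2 * Real.pi * β) * (h x
: EuclideanSpace ℝ (Fin 5)) 3, Real.sin (2 * Real.pi * β) * (h x : EuclideanSpace ℝ (Fin 5)) 2 +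
Real.cos (2 * Real.pi * β) * (h x : EuclideanSpace ℝ (Fin 5)) 3, (h x : EuclideanSpace ℝ (Fin 5))
4]) → ∃ θ : Diffeomorph (𝓡 4) (𝓡 4) M (Metric.sphere (0 : EuclideanSpace ℝ (Fin 5)) 1) (⊤ : ℕ∞), ∀ x
: M, ((θ (F x) : Metric.sphere (0 : EuclideanSpace ℝ (Fin 5)) 1) : EuclideanSpace ℝ (Fin 5)) =
WithLp.toLp 2 ![Real.cos (2 * Real.pi * α) * (θ x : EuclideanSpace ℝ (Fin 5)) 0 - Real.sin (2 *
Real.pi * α) * (θ x : EuclideanSpace ℝ (Fin 5)) 1, Real.sin (2 * Real.pi * α) * (θ x :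
EuclideanSpace ℝ (Fin 5)) 0 + Real.cos (2 * Real.pi * α) * (θ x : EuclideanSpace ℝ (Fin 5)) 1,
Real.cos (2 * Real.pi * β) * (θ x : EuclideanSpace ℝ (Fin 5)) 2 - Real.sin (2 * Real.pi * β) * (θ x
: EuclideanSpace ℝ (Fin 5)) 3, Real.sin (2 * Real.pi * β) * (θ x : EuclideanSpace ℝ (Fin 5)) 2 +
Real.cos (2 * Real.pi * β) * (θ x : EuclideanSpace ℝ (Fin 5)) 3, (θ x : EuclideanSpace ℝ (Fin 5))
4]) ∧ (∀ (M : Type) [TopologicalSpace M] [T2Space M] [SecondCountableTopology M] [ChartedSpace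
(EuclideanSpace ℝ (Fin 4)) M] [IsManifold (𝓡 4) (⊤ : ℕ∞) M], Nonempty (M ≃ₕ Metric.sphere (0 :
EuclideanSpace ℝ (Fin 5)) 1) → ∃ (F : Diffeomorph (𝓡 4) (𝓡 4) M M (⊤ : ℕ∞)) (h : M ≃ₜ Metric.sphere
(0 : EuclideanSpace ℝ (Fin 5)) 1) (α β : ℝ), (∃ γ τ : ℝ, 0 < γ ∧ ∀ k₁ k₂ m : ℤ, (k₁ ≠ 0 ∨ k₂ ≠ 0) →
γ ≤ |(k₁ : ℝ) * α + (k₂ : ℝ) * β + (m : ℝ)| * (|(k₁ : ℝ)| + |(k₂ : ℝ)|) ^ τ) ∧ (∀ x : M, ((h (F x) :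
Metric.sphere (0 : EuclideanSpace ℝ (Fin 5)) 1) : EuclideanSpace ℝ (Fin 5)) = WithLp.toLp 2
![Real.cos (2 * Real.pi * α) * (h x : EuclideanSpace ℝ (Fin 5)) 0 - Real.sin (2 * Real.pi * α) * (h
x : EuclideanSpace ℝ (Fin 5)) 1, Real.sin (2 * Real.pi * α) * (h x : EuclideanSpace ℝ (Fin 5)) 0 +
Real.cos (2 * Real.pi * α) * (h x : EuclideanSpace ℝ (Fin 5)) 1, Real.cos (2 * Real.pi * β) * (h x :
EuclideanSpace ℝ (Fin 5)) 2 - Real.sin (2 * Real.pi * β) * (h x : EuclideanSpace ℝ (Fin 5)) 3,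
Real.sin (2 * Real.pi * β) * (h x : EuclideanSpace ℝ (Fin 5)) 2 + Real.cos (2 * Real.pi * β) * (h x
: EuclideanSpace ℝ (Fin 5)) 3, (h x : EuclideanSpace ℝ (Fin 5)) 4]))`

## Assembly
Pure logic (4 tactic lines, sorry-free in Sketch.lean and in glue.lean): unfold `SmoothPoincare4` to
its binders (M Hausdorff second countable, a C^∞
atlas on ℝ⁴, e : M ≃ₕ S⁴); QuasiPeriodicExistence gives (F, h, α, β) with the Diophantine condition
and the pointwise conjugacy; DiophantineRigidity
returns θ : M ≃ₘ S⁴; `exact ⟨θ⟩`. LocalDiophantineRigidity ⇒ PuncturedConeRigidity is one line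
(`localDiophantineRigidity_imp_punctured` in the
sketch); the local cruxes and NoIdling are deliberately NOT hypotheses of `closes` (no decorative
hypothesis), exactly as the engine cruxes of
CyclicSymmetryRung.

Rationale: WHY THIS LINE. Import KAM / elliptic smooth dynamics (Herman1979, Yoccoz1984;
AvilaFayadLeCalvezXuZhang arXiv:1509.06906; WangZhang arXiv:1708.02529 and the
Norton–Sullivan question; FayadKrikorian2009) as the RECOGNISER of the standard smooth structure:
Freedman's homeomorphism transports the linear
torus action of S⁴ to any Σ continuously (Denjoy's rung), and the smooth 4-dimensional Poincaré
conjecture becomes "a smooth map that rotates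
quasi-periodically with Diophantine frequencies rotates smoothly" (K1) plus "a fake sphere can be
spun" (K2); the dictionary is exact — Denjoy ↦
Freedman1982, Herman–Yoccoz ↦ K1, Arnold–Herman Liouville examples ↦ the failure of K1 without
arithmetic, Siegel/Pérez-Marco at a fixed point ↦
the local rungs. No route of the 52 uses a single map, a C⁰ datum or small divisors: the symmetry
routes (CyclicSymmetryRung, QuotientSpheres,
ExoticMirrors) need a GROUP of isometries or a finite action with fixed data and run on compactness,
the other recognisers are curvature, entropy,
handles or holomorphic curves. K1 has content on S⁴ itself (it is refutable without deciding SPC4),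
K2 asks of a fake sphere strictly less than a
diffeomorphism (one smooth symmetry of infinite order compatible with the topological linear
structure), and both outcomes are theorems one wants:
¬SPC4 ∧ K1 says exotic 4-spheres admit no C⁰-linearisable quasi-periodic smooth dynamics at all.

RANKED CRUXES. #0 Target (target) — X = K1 ∧ K2 (DiophantineRigidity ∧ QuasiPeriodicExistence),
bodies inlined. (why it might fail: K2 ∧ K1 ⟺ SPC4 given K1, and K1 is a Herman-type global rigidity
statement open already for the 2-disc/2-torus (Norton–Sullivan 1996); an exotic Σ carrying
Diophantine quasi-periodic smooth dynamics kills K1, one carrying none kills K2.) [arXiv:1708.02529,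
arXiv:1509.06906, Herman1979, Kirby1997]
#2 DiophantineRigidity (crux) — (K1, card item K1 in smooth-linearisation form) for every smooth
4-manifold M (SPC4 binders), every diffeomorphism F : M ≃ₘ M, every homeomorphism h : M ≃ₜ S⁴ and
every simultaneously Diophantine (α,β) with h ∘ F = R_{α,β} ∘ h pointwise (coordinates of S⁴ ⊂ ℝ⁵
written out), there is a diffeomorphism θ : M ≃ₘ S⁴ with θ ∘ F = R_{α,β} ∘ θ. [difficulty:
open-problem] (why it might fail: global C⁰⇒C^∞ rigidity of Diophantine quasi-periodic maps is open
even on T² and the 2-disc (Norton–Sullivan Q1; only KAM-local results); poles and isotropy 2-spheres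
add resonances with no twist; an Anosov–Katok-type smooth realisation with Diophantine frequencies
kills it.) [arXiv:1708.02529, arXiv:1509.06906, Herman1979, Yoccoz1984, FayadKrikorian2009]
#3 QuasiPeriodicExistence (crux) — (K2, card item K2) every smooth homotopy 4-sphere M (SPC4
binders, M ≃ₕ S⁴) carries a diffeomorphism F, a homeomorphism h : M ≃ₜ S⁴ and a simultaneously
Diophantine (α,β) with h ∘ F = R_{α,β} ∘ h. [deps: DiophantineRigidity] [difficulty: open-problem]
(why it might fail: SPC4-implied (take F = R on S⁴), so refutable only by an exotic Σ; for exotic Σ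
it is exactly ¬K1|Σ — the smooth generator must preserve Freedman's (wild) orbit tori through the
cork region and no construction beyond S⁴ is known; K1 true would make K2 ⟺ SPC4.) [Freedman1982,
FreedmanQuinn1990, Fintushel1978, Pao1978]
#4 LocalDiophantineRigidity (crux) — (LL, new; the pole case of K1, Σ-free) let G be a C^∞
diffeomorphism of ℝ⁴ fixing 0 and ψ a homeomorphism of ℝ⁴ fixing 0 with ψ ∘ G = L ∘ ψ on a
neighbourhood of 0, L = the linear Diophantine bi-rotation of ℝ⁴ = ℂ²; then G is C^∞-linearisable at
0: some local diffeomorphism θ (an OpenPartialHomeomorph, C^∞ with C^∞ inverse, θ 0 = 0) satisfies θ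
∘ G = L ∘ θ near 0. [difficulty: open-problem] (why it might fail: Siegel-type form of Herman's
problem: for holomorphic germs top ⇒ analytic linearisability is Pérez-Marco's theorem, but for real
C^∞ germs with a merely C⁰ conjugacy the invariant tori may be too wild for KAM; one smooth
non-linearisable germ C⁰-conjugate to a Diophantine rotation of ℝ² kills it.) [PerezMarco1997,
Herman1979, arXiv:1509.06906, Russmann2002]
#5 PuncturedConeRigidity (crux) — (LL°, new; first rung — LL with the conjugacy ψ assumed C^∞ with
C^∞ inverse OFF the fixed point) same conclusion: G is C^∞-linearisable at 0. Reading: an 'exotic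
cone point' (a smoothing of (ℝ⁴,0) standard off 0) over which the rigid Diophantine product rotation
of S³×(0,ε) extends smoothly is smoothly standard for that rotation. Plan: topological conjugacy
kills all resonant (drift and twist) terms of the formal normal form, Borel summation leaves a flat
remainder, and the flat conjugacy equation is solved fibrewise on the spheres S³_r by the
Diophantine small-divisor estimates for the T²-rotation of S³ (tame inverse of f ↦ f∘L − L∘f off the
centraliser), uniformly in r. [difficulty: L] (why it might fail: the fibrewise conjugators σ_r (r >
0) must be normalised modulo the centraliser of L smoothly down to r = 0: a TAME local section of
the conjugation map of Diff(S³) at the Diophantine rotation (Nash–Moser); if the conjugacy class of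
L is not tamely embedded this fails as for Liouville frequencies.) [Herman1979, Zehnder1975,
Moser1966, Russmann2002]
#9 NoIdling (support) — (card Theorem D, isometric form; provable modulo Myers–Steenrod as a named
fact) a closed smooth homotopy 4-sphere M with a C^∞ Riemannian metric g
(Bundle.ContMDiffRiemannianMetric on the tangent bundle) and an isometry F : M ≃ₘ M of g (g(F x)(dF
v, dF w) = g x (v,w)) of infinite order ((⇑F)^[n] ≠ id for n ≥ 1) carries a smooth effective circle
action (hence M ≅ S⁴ by the tree fact fintushelPao_circleAction_homotopySphere_four, not named in
the statement). Proof: Isom(M,g) is a compact Lie group acting smoothly (Myers–Steenrod); the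
closure of ⟨F⟩ is infinite, so its identity component is a torus ⊇ S¹. [difficulty: L]
[MyersSteenrod1939, Palais1970, RepovsScepin1997, Fintushel1978]

TWO-LAYER PLAN. K1 ⇐ LocalDiophantineRigidity (poles) → AnnulusRigidity (the same statement on the
h-cobordism M minus two invariant balls ≃ S³×I, with smooth
conjugacy near the boundary) → K1; PuncturedConeRigidity ⇐ FormalLinearisation (no resonant terms
under topological conjugacy) → FlatConjugacy
(fibrewise small divisors on S³) → PuncturedConeRigidity; K2 ⇐ InvariantConjugacy (choose Freedman's
h with h(singular 2-complex nbhd) a union of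
R-orbit closures) → SmoothGenerator → K2 (k ≤ 3 each, depth 1; nothing filed now).

KILL CRITERIA. A C^∞ diffeomorphism of the STANDARD S⁴ (or of ℝ⁴ near 0, or of S³, T², D²)
C⁰-conjugate to a Diophantine rotation but not C¹-conjugate refutes
DiophantineRigidity (resp. LocalDiophantineRigidity) without touching SPC4 — close
`refuted:DiophantineRigidity` and keep PuncturedConeRigidity /
NoIdling as Literature-level salvage; a refutation of PuncturedConeRigidity (tame-section failure at
a Diophantine rotation of S³) forces a pivot
to the isometric rung (NoIdling + an existence statement for infinite-order isometries = card
conformal-rigidity-rung, known zero-slack) i.e.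
retirement. QuasiPeriodicExistence is refutable only by an exotic S⁴. SPC4 proved elsewhere moots K2
and leaves K1 as a dynamics problem.

NOT DECOMPOSED YET. The global-from-local part of K1 (invariant tori of a smooth map C⁰-conjugate to
a Diophantine translation are smooth — a renormalisation /
a-priori-bound statement in the style of Avila–Krikorian), the Liouville counterexamples
(DiophantineRigidity is expected FALSE for Liouville
(α,β) by Anosov–Katok / Herman ch. XI suspended over S⁴ — a disprover's `_false_without_Diophantine`
target, not an item), the C^k versions
(finite loss of derivatives), and any construction toward K2 (quasi-periodic Kirby problem) — all
layer-2.

CHEAPEST FALSIFIER. Literature lookup (run 2026-08-16, zbMATH + arXiv; local index down): is there,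
in ANY dimension, a C^∞ map topologically conjugate to a
DIOPHANTINE rigid rotation/translation that is not C¹-conjugate to it? Found none: dimension 1 is
Herman–Yoccoz (impossible); in dimension 2 the
question is open (Norton–Sullivan 1996 Question 1 as quoted in arXiv:1708.02529 p.5; Wang–Zhang's
non-linearisable examples Thm 5 and
Fayad–Saprykina / Anosov–Katok maps are Liouville or not C⁰-conjugate; Avila–Krikorian announce
almost-reducibility near rotations). The
first in-Lean check for a disprover: the linear R itself satisfies every hypothesis of each item on
S⁴ / ℝ⁴ (non-vacuity), and F = id does not
(α ∉ ℤ), so no junk model refutes K1.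

NUMBERS. Diophantine exponent: pairs (α,β) with γ ≤ |k₁α+k₂β+m|(|k₁|+|k₂|)^τ exist for every τ > 2
(full measure) and for τ = 2 + ε with algebraic
(1,α,β) ℚ-independent (Schmidt); the condition as typed implies α, β, k₁α+k₂β ∉ ℚ (no resonances).
Items at open: 7 (target, 4 cruxes, 1 support,
assembly).

DEFINITION REQUESTS. None: everything is stated over Mathlib (Diffeomorph, Homeomorph,
OpenPartialHomeomorph, ContDiff/ContDiffOn, Bundle.ContMDiffRiemannianMetric,
mfderiv, Circle, ContMDiffSMul); the bi-rotation is written out in the coordinates of EuclideanSpace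
ℝ (Fin 5) / (Fin 4) inside each item.

Novelty: Searches (2026-08-16; `lit search` local tier DOWN (searchd connection reset), OpenAlex/S2 429):
`lit search --source zbmath "irrational pseudo-rotation"`
(10: Bramham arXiv:1205.6243, Béguin–Crovisier–Le Roux math/0506041, Jäger arXiv:0803.2428,
Wang–Zhang arXiv:1708.02529, Le Calvez ×2, … — all
dimension ≤ 2, none mentions 4-manifolds); `… "pseudo-rotations rigidity"` (4: AFLXZ
arXiv:1509.06906, Joksimović–Seyfaddini 2207.11813, Wang–Zhang,
Katok legacy volume); `… "topologically conjugate rotation smoothly conjugate Diophantine sphere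
diffeomorphism"`, `"exotic sphere quasi-periodic
diffeomorphism"`, `"Herman rigidity higher dimension …"`, `"smooth linearization elliptic fixed
point topologically conjugate"` (0 each);
`lit search --source arxiv "pseudo-rotation sphere Diophantine"` (0); `lit read arxiv:1708.02529`
(pp.5–7 read: Norton–Sullivan Q1, Avila–Krikorian
announcement, Questions 2–4); hub pool: 52 route mechanism labels (no dynamics), 160 cards (only the
spine card and conformal-rigidity-rung /
large-cyclic-symmetry-rung touch symmetry-by-compactness).
Nearest prior art found: card fake-spheres-cannot-idle (the spine, unrouted, critic grade
new-combination); route CyclicSymmetryRung and barrier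
Literature.Barriers.SmoothPoincare4.CircleActionBarrierFour (symmetry ⇒ S⁴ endpoint, by compactness
of isometry families); in print Herman1979 /
Yoccoz1984 (dim 1), arXiv:1708.02529 and arXiv:1509.06906 (dim 2) — never pointed at a
smooth-structure problem.
Delta: the recogn  [refs: 1205.6243, 0803.2428, 1708.02529, 1509.06906, arxiv:1708.02529]

Barriers (technique_class: elliptic-dynamics-rigidity, kam-small-divisors): - technique_class: elliptic-dynamics-rigidity, kam-small-divisors
- Literature.Barriers.SmoothPoincare4.CircleActionBarrierFour: not fought — it (Fintushel–Pao) is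
the endpoint behind NoIdling only; K1 concludes a diffeomorphism directly and lives strictly below
the barrier's class (single maps and C⁰ conjugacies, where it says nothing).
- Literature.Barriers.SmoothPoincare4.ProjectiveRigidityBarrierFour: respected — finite-order maps
are excluded (the Diophantine condition forces infinite order), consistent with exotic free
involutions covered by S⁴.
- Literature.Barriers.SmoothPoincare4.TopologicalBarrierFour: evaded — nothing is computed from the
TOP manifold; the homeomorphism h is an input whose REGULARITY is the question.
- Literature.Barriers.SmoothPoincare4.GaugeSumBarrierFour: not engaged (also StableBarrierFour,
HCobordismInvariantBarrierFour) — no invariant of Σ is evaluated; the output is a diffeomorphism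
produced by a linearisation scheme.
- Literature.Barriers.SmoothPoincare4.HCobordismBarrierFour: not engaged (also
TwistedSphereBarrierFour) — no h-cobordism or clutching argument; §D.1 shielding is CONCEDED for K2
(SPC4-implied existence half) and does not apply to K1, LL, LL° (content on S⁴ / ℝ⁴).
- Negatives index: empty for SmoothPoincare4 at filing (ledger negatives: 0 refuted statements);
nothing refuted is reused; §D.2 junk list run over every signature (empty M impossible under `M ≃ₜ
S⁴` / `M ≃ₕ S⁴`; F = id excluded by α ∉ ℤ; the linear R is a non-vacuity

History (route lifecycle, newest last):
- 2026-08-24T15:43:20Z · DORMANT — reconciler: no traction for 6.9 d (last activity item-evidence-added at 2026-08-17T18:12:59Z); parked, not closed — `ledger route dormant route-SmoothPoincare4- (operator:999:1554651)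

sub-problem: SmoothPoincare4 · status: dormant · opened planner-plan-novel-SmoothPoincare4-SmoothPoinca-1b483c27-v2-g6-0 2026-08-16T20:05:22Z · rev 2 · ledger route-SmoothPoincare4-DiophantineRotations
GENERATED by the gate from the ledger (D-0016/17). Provers cite these decls: `theorem foo : Summit.SmoothPoincare4.SmoothPoincare4.Theses.DiophantineRotations.<Decl> := …` in Summits/SmoothPoincare4/SmoothPoincare4/Theorems/<Name>.lean.
-/

namespace Summit.SmoothPoincare4.SmoothPoincare4.Theses.DiophantineRotations

open scoped BigOperators Topology Manifold Classical MeasureTheory ProbabilityTheory Matrix InnerProductSpace ComplexConjugate ContinuousMap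
open Filter Set Function TopologicalSpace MeasureTheory

attribute [summit_statement] _root_.SmoothPoincare4

open Literature.SPC4

/-- item stmt-SmoothPoincare4-16606 · target · rank 0 · open · by planner
why it might fail: K2 ∧ K1 ⟺ SPC4 given K1, and K1 is a Herman-type global rigidity statement open already for the 2-disc/2-torus (Norton–Sullivan 1996); an exotic Σ carrying Diophantine quasi-periodic smooth dynamics kills K1, one carrying none kills K2.
sources: arXiv:1708.02529, arXiv:1509.06906, Herman1979, Kirby1997
[target] X = K1 ∧ K2 (DiophantineRigidity ∧ QuasiPeriodicExistence), bodies inlined. -/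
@[route_item "route-SmoothPoincare4-DiophantineRotations"]
def Target : Prop :=
  (∀ (M : Type) [TopologicalSpace M] [T2Space M] [SecondCountableTopology M] [ChartedSpace (EuclideanSpace ℝ (Fin 4)) M] [IsManifold (𝓡 4) (⊤ : ℕ∞) M] (F : Diffeomorph (𝓡 4) (𝓡 4) M M (⊤ : ℕ∞)) (h : M ≃ₜ Metric.sphere (0 : EuclideanSpace ℝ (Fin 5)) 1) (α β : ℝ), (∃ γ τ : ℝ, 0 < γ ∧ ∀ k₁ k₂ m : ℤ, (k₁ ≠ 0 ∨ k₂ ≠ 0) → γ ≤ |(k₁ : ℝ) * α + (k₂ : ℝ) * β + (m : ℝ)| * (|(k₁ : ℝ)| + |(k₂ : ℝ)|) ^ τ) → (∀ x : M, ((h (F x) : Metric.sphere (0 : EuclideanSpace ℝ (Fin 5)) 1) : EuclideanSpace ℝ (Fin 5)) = WithLp.toLp 2 ![Real.cos (2 * Real.pi * α) * (h x : EuclideanSpace ℝ (Fin 5)) 0 - Real.sin (2 * Real.pi * α) * (h x : EuclideanSpace ℝ (Fin 5)) 1, Real.sin (2 * Real.pi * α) * (h x : EuclideanSpace ℝ (Fin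 5)) 0 + Real.cos (2 * Real.pi * α) * (h x : EuclideanSpace ℝ (Fin 5)) 1, Real.cos (2 * Real.pi * β) * (h x : EuclideanSpace ℝ (Fin 5)) 2 - Real.sin (2 * Real.pi * β) * (h x : EuclideanSpace ℝ (Fin 5)) 3, Real.sin (2 * Real.pi * β) * (h x : EuclideanSpace ℝ (Fin 5)) 2 + Real.cos (2 * Real.pi * β) * (h x : EuclideanSpace ℝ (Fin 5)) 3, (h x : EuclideanSpace ℝ (Fin 5)) 4]) → ∃ θ : Diffeomorph (𝓡 4) (𝓡 4) M (Metric.sphere (0 : EuclideanSpace ℝ (Fin 5)) 1) (⊤ : ℕ∞), ∀ x : M, ((θ (F x) : Metric.sphere (0 : EuclideanSpace ℝ (Fin 5)) 1) : EuclideanSpace ℝ (Fin 5)) = WithLp.toLp 2 ![Real.cos (2 * Real.pi * α) * (θ x : EuclideanSpace ℝ (Fin 5)) 0 - Real.sin (2 * Real.pi * α) * (θ x : EuclideanSpace ℝ (Fin 5)) 1, Real.sin (2 * Real.pi * α) * (θ x : EuclideanSpace ℝ (Fin 5)) 0 + Real.cos (2 * Real.pi * α) * (θ x : EuclideanSpace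 ℝ (Fin 5)) 1, Real.cos (2 * Real.pi * β) * (θ x : EuclideanSpace ℝ (Fin 5)) 2 - Real.sin (2 * Real.pi * β) * (θ x : EuclideanSpace ℝ (Fin 5)) 3, Real.sin (2 * Real.pi * β) * (θ x : EuclideanSpace ℝ (Fin 5)) 2 + Real.cos (2 * Real.pi * β) * (θ x : EuclideanSpace ℝ (Fin 5)) 3, (θ x : EuclideanSpace ℝ (Fin 5)) 4]) ∧ (∀ (M : Type) [TopologicalSpace M] [T2Space M] [SecondCountableTopology M] [ChartedSpace (EuclideanSpace ℝ (Fin 4)) M] [IsManifold (𝓡 4) (⊤ : ℕ∞) M], Nonempty (M ≃ₕ Metric.sphere (0 : EuclideanSpace ℝ (Fin 5)) 1) → ∃ (F : Diffeomorph (𝓡 4) (𝓡 4) M M (⊤ : ℕ∞)) (h : M ≃ₜ Metric.sphere (0 : EuclideanSpace ℝ (Fin 5)) 1) (α β : ℝ), (∃ γ τ : ℝ, 0 < γ ∧ ∀ k₁ k₂ m : ℤ, (k₁ ≠ 0 ∨ k₂ ≠ 0) → γ ≤ |(k₁ : ℝ) * α + (k₂ : ℝ) * β + (m : ℝ)| *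 (|(k₁ : ℝ)| + |(k₂ : ℝ)|) ^ τ) ∧ (∀ x : M, ((h (F x) : Metric.sphere (0 : EuclideanSpace ℝ (Fin 5)) 1) : EuclideanSpace ℝ (Fin 5)) = WithLp.toLp 2 ![Real.cos (2 * Real.pi * α) * (h x : EuclideanSpace ℝ (Fin 5)) 0 - Real.sin (2 * Real.pi * α) * (h x : EuclideanSpace ℝ (Fin 5)) 1, Real.sin (2 * Real.pi * α) * (h x : EuclideanSpace ℝ (Fin 5)) 0 + Real.cos (2 * Real.pi * α) * (h x : EuclideanSpace ℝ (Fin 5)) 1, Real.cos (2 * Real.pi * β) * (h x : EuclideanSpace ℝ (Fin 5)) 2 - Real.sin (2 * Real.pi * β) * (h x : EuclideanSpace ℝ (Fin 5)) 3, Real.sin (2 * Real.pi * β) * (h x : EuclideanSpace ℝ (Fin 5)) 2 + Real.cos (2 * Real.pi * β) * (h x : EuclideanSpace ℝ (Fin 5)) 3, (h x : EuclideanSpace ℝ (Fin 5)) 4]))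

/-- item stmt-SmoothPoincare4-16607 · crux · rank 2 · open · by planner
why it might fail: global C⁰⇒C^∞ rigidity of Diophantine quasi-periodic maps is open even on T² and the 2-disc (Norton–Sullivan Q1; only KAM-local results); poles and isotropy 2-spheres add resonances with no twist; an Anosov–Katok-type smooth realisation with Diophantine frequencies kills it.
sources: arXiv:1708.02529, arXiv:1509.06906, Herman1979, Yoccoz1984, FayadKrikorian2009
[crux] (K1, card item K1 in smooth-linearisation form) for every smooth 4-manifold M (SPC4 binders),
every diffeomorphism F : M ≃ₘ M, every homeomorphism h : M ≃ₜ S⁴ and every simultaneously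
Diophantine (α,β) with h ∘ F = R_{α,β} ∘ h pointwise (coordinates of S⁴ ⊂ ℝ⁵ written out), there is
a diffeomorphism θ : M ≃ₘ S⁴ with θ ∘ F = R_{α,β} ∘ θ. [difficulty: open-problem] -/
@[route_item "route-SmoothPoincare4-DiophantineRotations", crux]
def DiophantineRigidity : Prop :=
  ∀ (M : Type) [TopologicalSpace M] [T2Space M] [SecondCountableTopology M] [ChartedSpace (EuclideanSpace ℝ (Fin 4)) M] [IsManifold (𝓡 4) (⊤ : ℕ∞) M] (F : Diffeomorph (𝓡 4) (𝓡 4) M M (⊤ : ℕ∞)) (h : M ≃ₜ Metric.sphere (0 : EuclideanSpace ℝ (Fin 5)) 1) (α β : ℝ), (∃ γ τ : ℝ, 0 < γ ∧ ∀ k₁ k₂ m : ℤ, (k₁ ≠ 0 ∨ k₂ ≠ 0) → γ ≤ |(k₁ : ℝ) * α + (k₂ : ℝ) * β + (m : ℝ)| * (|(k₁ : ℝ)| + |(k₂ : ℝ)|) ^ τ) → (∀ x : M, ((h (F x) : Metric.sphere (0 : EuclideanSpace ℝ (Fin 5)) 1) : EuclideanSpace ℝ (Fin 5)) = WithLp.toLp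 2 ![Real.cos (2 * Real.pi * α) * (h x : EuclideanSpace ℝ (Fin 5)) 0 - Real.sin (2 * Real.pi * α) * (h x : EuclideanSpace ℝ (Fin 5)) 1, Real.sin (2 * Real.pi * α) * (h x : EuclideanSpace ℝ (Fin 5)) 0 + Real.cos (2 * Real.pi * α) * (h x : EuclideanSpace ℝ (Fin 5)) 1, Real.cos (2 * Real.pi * β) * (h x : EuclideanSpace ℝ (Fin 5)) 2 - Real.sin (2 * Real.pi * β) * (h x : EuclideanSpace ℝ (Fin 5)) 3, Real.sin (2 * Real.pi * β) * (h x : EuclideanSpace ℝ (Fin 5)) 2 + Real.cos (2 * Real.pi * β) * (h x : EuclideanSpace ℝ (Fin 5)) 3, (h x : EuclideanSpace ℝ (Fin 5)) 4]) → ∃ θ : Diffeomorph (𝓡 4) (𝓡 4) M (Metric.sphere (0 : EuclideanSpace ℝ (Fin 5)) 1) (⊤ : ℕ∞), ∀ x : M, ((θ (F x) : Metric.sphere (0 : EuclideanSpace ℝ (Fin 5)) 1) : EuclideanSpace ℝ (Fin 5)) = WithLp.toLp 2 ![Real.cos (2 * Real.pi * α) * (θ x : EuclideanSpace ℝ (Fin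 5)) 0 - Real.sin (2 * Real.pi * α) * (θ x : EuclideanSpace ℝ (Fin 5)) 1, Real.sin (2 * Real.pi * α) * (θ x : EuclideanSpace ℝ (Fin 5)) 0 + Real.cos (2 * Real.pi * α) * (θ x : EuclideanSpace ℝ (Fin 5)) 1, Real.cos (2 * Real.pi * β) * (θ x : EuclideanSpace ℝ (Fin 5)) 2 - Real.sin (2 * Real.pi * β) * (θ x : EuclideanSpace ℝ (Fin 5)) 3, Real.sin (2 * Real.pi * β) * (θ x : EuclideanSpace ℝ (Fin 5)) 2 + Real.cos (2 * Real.pi * β) * (θ x : EuclideanSpace ℝ (Fin 5)) 3, (θ x : EuclideanSpace ℝ (Fin 5)) 4]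

/-- item stmt-SmoothPoincare4-16608 · crux · rank 3 · open · by planner
why it might fail: SPC4-implied (take F = R on S⁴), so refutable only by an exotic Σ; for exotic Σ it is exactly ¬K1|Σ — the smooth generator must preserve Freedman's (wild) orbit tori through the cork region and no construction beyond S⁴ is known; K1 true would make K2 ⟺ SPC4.
sources: Freedman1982, FreedmanQuinn1990, Fintushel1978, Pao1978
[crux] (K2, card item K2) every smooth homotopy 4-sphere M (SPC4 binders, M ≃ₕ S⁴) carries a
diffeomorphism F, a homeomorphism h : M ≃ₜ S⁴ and a simultaneously Diophantine (α,β) with h ∘ F =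
R_{α,β} ∘ h. [deps: DiophantineRigidity] [difficulty: open-problem] -/
@[route_item "route-SmoothPoincare4-DiophantineRotations", crux]
def QuasiPeriodicExistence : Prop :=
  ∀ (M : Type) [TopologicalSpace M] [T2Space M] [SecondCountableTopology M] [ChartedSpace (EuclideanSpace ℝ (Fin 4)) M] [IsManifold (𝓡 4) (⊤ : ℕ∞) M], Nonempty (M ≃ₕ Metric.sphere (0 : EuclideanSpace ℝ (Fin 5)) 1) → ∃ (F : Diffeomorph (𝓡 4) (𝓡 4) M M (⊤ : ℕ∞)) (h : M ≃ₜ Metric.sphere (0 : EuclideanSpace ℝ (Fin 5)) 1) (α β : ℝ), (∃ γ τ : ℝ, 0 < γ ∧ ∀ k₁ k₂ m : ℤ, (k₁ ≠ 0 ∨ k₂ ≠ 0) → γ ≤ |(k₁ : ℝ) * α + (k₂ : ℝ) * β + (m : ℝ)| * (|(k₁ : ℝ)| + |(k₂ : ℝ)|) ^ τ) ∧ (∀ x : M, ((h (F x) : Metric.sphere (0 : EuclideanSpace ℝ (Fin 5)) 1) : EuclideanSpace ℝ (Fin 5)) = WithLp.toLp 2 ![Real.cos (2 * Real.pi * α)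 * (h x : EuclideanSpace ℝ (Fin 5)) 0 - Real.sin (2 * Real.pi * α) * (h x : EuclideanSpace ℝ (Fin 5)) 1, Real.sin (2 * Real.pi * α) * (h x : EuclideanSpace ℝ (Fin 5)) 0 + Real.cos (2 * Real.pi * α) * (h x : EuclideanSpace ℝ (Fin 5)) 1, Real.cos (2 * Real.pi * β) * (h x : EuclideanSpace ℝ (Fin 5)) 2 - Real.sin (2 * Real.pi * β) * (h x : EuclideanSpace ℝ (Fin 5)) 3, Real.sin (2 * Real.pi * β) * (h x : EuclideanSpace ℝ (Fin 5)) 2 + Real.cos (2 * Real.pi * β) * (h x : EuclideanSpace ℝ (Fin 5)) 3, (h x : EuclideanSpace ℝ (Fin 5)) 4])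

/-- item stmt-SmoothPoincare4-16609 · crux · rank 4 · open · by planner
why it might fail: Siegel-type form of Herman's problem: for holomorphic germs top ⇒ analytic linearisability is Pérez-Marco's theorem, but for real C^∞ germs with a merely C⁰ conjugacy the invariant tori may be too wild for KAM; one smooth non-linearisable germ C⁰-conjugate to a Diophantine rotation of ℝ² kills it.
sources: PerezMarco1997, Herman1979, arXiv:1509.06906, Russmann2002
[crux] (LL, new; the pole case of K1, Σ-free) let G be a C^∞ diffeomorphism of ℝ⁴ fixing 0 and ψ a
homeomorphism of ℝ⁴ fixing 0 with ψ ∘ G = L ∘ ψ on a neighbourhood of 0, L = the linear Diophantine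
bi-rotation of ℝ⁴ = ℂ²; then G is C^∞-linearisable at 0: some local diffeomorphism θ (an
OpenPartialHomeomorph, C^∞ with C^∞ inverse, θ 0 = 0) satisfies θ ∘ G = L ∘ θ near 0. [difficulty:
open-problem] -/
@[route_item "route-SmoothPoincare4-DiophantineRotations"]
def LocalDiophantineRigidity : Prop :=
  ∀ (α β : ℝ), (∃ γ τ : ℝ, 0 < γ ∧ ∀ k₁ k₂ m : ℤ, (k₁ ≠ 0 ∨ k₂ ≠ 0) → γ ≤ |(k₁ : ℝ) * α + (k₂ : ℝ) * β + (m : ℝ)| * (|(k₁ : ℝ)| + |(k₂ : ℝ)|) ^ τ) → ∀ (G ψ : EuclideanSpace ℝ (Fin 4) ≃ₜ EuclideanSpace ℝ (Fin 4)), ContDiff ℝ (⊤ : ℕ∞) (⇑G) → ContDiff ℝ (⊤ : ℕ∞) (⇑G.symm) → G 0 = 0 → ψ 0 = 0 → (∀ᶠ x in nhds (0 : EuclideanSpace ℝ (Fin 4)), ψ (G x) = WithLp.toLp 2 ![Real.cos (2 * Real.pi * α) * (ψ x) 0 - Real.sin (2 * Real.pi * α) * (ψ x) 1, Real.sin (2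 * Real.pi * α) * (ψ x) 0 + Real.cos (2 * Real.pi * α) * (ψ x) 1, Real.cos (2 * Real.pi * β) * (ψ x) 2 - Real.sin (2 * Real.pi * β) * (ψ x) 3, Real.sin (2 * Real.pi * β) * (ψ x) 2 + Real.cos (2 * Real.pi * β) * (ψ x) 3]) → ∃ θ : OpenPartialHomeomorph (EuclideanSpace ℝ (Fin 4)) (EuclideanSpace ℝ (Fin 4)), (0 : EuclideanSpace ℝ (Fin 4)) ∈ θ.source ∧ θ 0 = 0 ∧ ContDiffOn ℝ (⊤ : ℕ∞) (⇑θ) θ.source ∧ ContDiffOn ℝ (⊤ : ℕ∞) (⇑θ.symm) θ.target ∧ ∀ᶠ x in nhds (0 : EuclideanSpace ℝ (Fin 4)), θ (G x) = WithLp.toLp 2 ![Real.cos (2 * Real.pi * α) * (θ x) 0 - Real.sin (2 * Real.pi * α) * (θ x) 1, Real.sin (2 * Real.pi * α) * (θ x) 0 + Real.cos (2 * Real.pi * α) * (θ x) 1, Real.cos (2 * Real.pi * β) * (θ x) 2 - Real.sin (2 * Real.pi * β) * (θ x) 3, Real.sin (2 * Real.pi * β) * (θ x) 2 + Real.cos (2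 * Real.pi * β) * (θ x) 3]

/-- item stmt-SmoothPoincare4-16610 · crux · rank 5 · open · by planner
why it might fail: the fibrewise conjugators σ_r (r > 0) must be normalised modulo the centraliser of L smoothly down to r = 0: a TAME local section of the conjugation map of Diff(S³) at the Diophantine rotation (Nash–Moser); if the conjugacy class of L is not tamely embedded this fails as for Liouville frequencies.
sources: Herman1979, Zehnder1975, Moser1966, Russmann2002
[crux] (LL°, new; first rung — LL with the conjugacy ψ assumed C^∞ with C^∞ inverse OFF the fixed
point) same conclusion: G is C^∞-linearisable at 0. Reading: an 'exotic cone point' (a smoothing of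
(ℝ⁴,0) standard off 0) over which the rigid Diophantine product rotation of S³×(0,ε) extends
smoothly is smoothly standard for that rotation. Plan: topological conjugacy kills all resonant
(drift and twist) terms of the formal normal form, Borel summation leaves a flat remainder, and the
flat conjugacy equation is solved fibrewise on the spheres S³_r by the Diophantine small-divisor
estimates for the T²-rotation of S³ (tame inverse of f ↦ f∘L − L∘f off the centraliser), uniformly
in r. [difficulty: L] -/
@[route_item "route-SmoothPoincare4-DiophantineRotations"]
def PuncturedConeRigidity : Prop :=
  ∀ (α β : ℝ), (∃ γ τ : ℝ, 0 < γ ∧ ∀ k₁ k₂ m : ℤ, (k₁ ≠ 0 ∨ k₂ ≠ 0) → γ ≤ |(k₁ : ℝ) * α + (k₂ : ℝ) * β + (m : ℝ)| * (|(k₁ : ℝ)| + |(k₂ : ℝ)|) ^ τ) → ∀ (G ψ : EuclideanSpace ℝ (Fin 4) ≃ₜ EuclideanSpace ℝ (Fin 4)), ContDiff ℝ (⊤ : ℕ∞) (⇑G) → ContDiff ℝ (⊤ : ℕ∞) (⇑G.symm) → G 0 = 0 → ψ 0 = 0 → ContDiffOn ℝ (⊤ : ℕ∞) (⇑ψ)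 {0}ᶜ → ContDiffOn ℝ (⊤ : ℕ∞) (⇑ψ.symm) {0}ᶜ → (∀ᶠ x in nhds (0 : EuclideanSpace ℝ (Fin 4)), ψ (G x) = WithLp.toLp 2 ![Real.cos (2 * Real.pi * α) * (ψ x) 0 - Real.sin (2 * Real.pi * α) * (ψ x) 1, Real.sin (2 * Real.pi * α) * (ψ x) 0 + Real.cos (2 * Real.pi * α) * (ψ x) 1, Real.cos (2 * Real.pi * β) * (ψ x) 2 - Real.sin (2 * Real.pi * β) * (ψ x) 3, Real.sin (2 * Real.pi * β) * (ψ x) 2 + Real.cos (2 * Real.pi * β) * (ψ x) 3]) → ∃ θ : OpenPartialHomeomorph (EuclideanSpace ℝ (Fin 4)) (EuclideanSpace ℝ (Fin 4)), (0 : EuclideanSpace ℝ (Fin 4)) ∈ θ.source ∧ θ 0 = 0 ∧ ContDiffOn ℝ (⊤ : ℕ∞) (⇑θ) θ.source ∧ ContDiffOn ℝ (⊤ : ℕ∞) (⇑θ.symm) θ.target ∧ ∀ᶠ x in nhds (0 : EuclideanSpace ℝ (Fin 4)), θ (G x) = WithLp.toLp 2 ![Real.cos (2 * Real.pi * α) *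 (θ x) 0 - Real.sin (2 * Real.pi * α) * (θ x) 1, Real.sin (2 * Real.pi * α) * (θ x) 0 + Real.cos (2 * Real.pi * α) * (θ x) 1, Real.cos (2 * Real.pi * β) * (θ x) 2 - Real.sin (2 * Real.pi * β) * (θ x) 3, Real.sin (2 * Real.pi * β) * (θ x) 2 + Real.cos (2 * Real.pi * β) * (θ x) 3]

/-- item stmt-SmoothPoincare4-16611 · support · rank 9 · open · by planner
sources: MyersSteenrod1939, Palais1970, RepovsScepin1997, Fintushel1978
[support] (card Theorem D, isometric form; provable modulo Myers–Steenrod as a named fact) a closed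
smooth homotopy 4-sphere M with a C^∞ Riemannian metric g (Bundle.ContMDiffRiemannianMetric on the
tangent bundle) and an isometry F : M ≃ₘ M of g (g(F x)(dF v, dF w) = g x (v,w)) of infinite order
((⇑F)^[n] ≠ id for n ≥ 1) carries a smooth effective circle action (hence M ≅ S⁴ by the tree fact
fintushelPao_circleAction_homotopySphere_four, not named in the statement). Proof: Isom(M,g) is a
compact Lie group acting smoothly (Myers–Steenrod); the closure of ⟨F⟩ is infinite, so its identity
component is a torus ⊇ S¹. [difficulty: L] -/
@[route_item "route-SmoothPoincare4-DiophantineRotations"]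
def NoIdling : Prop :=
  ∀ (M : Type) [TopologicalSpace M] [T2Space M] [SecondCountableTopology M] [ChartedSpace (EuclideanSpace ℝ (Fin 4)) M] [IsManifold (𝓡 4) (⊤ : ℕ∞) M] [CompactSpace M] (g : Bundle.ContMDiffRiemannianMetric (𝓡 4) (⊤ : ℕ∞) (EuclideanSpace ℝ (Fin 4)) (fun x : M => TangentSpace (𝓡 4) x)) (F : Diffeomorph (𝓡 4) (𝓡 4) M M (⊤ : ℕ∞)), Nonempty (M ≃ₕ Metric.sphere (0 : EuclideanSpace ℝ (Fin 5)) 1) → (∀ n : ℕ, 0 < n → (⇑F)^[n] ≠ id) → (∀ (x : M) (v w : TangentSpace (𝓡 4) x), g.inner (F x) (mfderiv (𝓡 4) (𝓡 4) F x v) (mfderiv (𝓡 4) (𝓡 4) F x w) = g.inner x v w) → ∃ _ : MulAction Circle M, FaithfulSMul Circle M ∧ ContMDiffSMul (𝓡 1) (𝓡 4) (⊤ : ℕ∞) Circle M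

/-- item stmt-SmoothPoincare4-16612 · assembly · rank 1 · open · by planner
sources: Kirby1997, Freedman1982
[assembly] DiophantineRigidity → QuasiPeriodicExistence → SmoothPoincare4. -/
@[route_item "route-SmoothPoincare4-DiophantineRotations"]
def Assembly : Prop :=
  DiophantineRigidity → QuasiPeriodicExistence → _root_.SmoothPoincare4

/-! D-0027 §2.1 — DECIDING THEOREM (planner-authored via `route open/edit --closes-file`; by planner-plan-novel-SmoothPoincare4-SmoothPoinca-1b483c27-v2- 2026-08-16T20:05:22Z):
its hypotheses are this route's items and its conclusion the sub-problem Statement (glue_lint), and it elaborates with this file. -/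

@[closes "route-SmoothPoincare4-DiophantineRotations"] theorem closes (hR : DiophantineRigidity) (hE : QuasiPeriodicExistence) : _root_.SmoothPoincare4 := by
  unfold _root_.SmoothPoincare4 Literature.SPC4.SmoothPoincareConjectureFour
    ContinuousMap.HomotopyEquiv.NonemptyDiffeomorphSphere
  intro M _ _ _ _ _ e
  obtain ⟨F, h, α, β, hD, hc⟩ := hE M ⟨e⟩
  obtain ⟨θ, -⟩ := hR M F h α β hD hc
  exact ⟨θ⟩

end Summit.SmoothPoincare4.SmoothPoincare4.Theses.DiophantineRotations
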